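import Summits.CriticalPhenomena.CardyFormulaZ2.Theorems.CardyIKTransportIKLinearTransportStubCoalescingRowKernelReduction
import Summits.CriticalPhenomena.CardyFormulaZ2.Theorems.CardyIKTransportIKLinearTransportStubCoalescingRowKernelReroute
import Summits.CriticalPhenomena.CardyFormulaZ2.Theorems.CardyIKTransportIKLinearTransportStubStripDiagramExchange
import Mathlib.Probability.Kernel.CondDistrib

/-!
# Stub `stub_CutMarkovKernel` (K) — part A: the ABSTRACT SUFFICIENCY LEMMA across an independent cut

Support file (`--supports stmt-CriticalPhenomena-5076`, registered sub-goal `cmk_abstract_sufficiency`).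

Toward the cut-Markov property (K) of the diagram-conditioned middle column (`CutMarkovKernel`,
`…StubCoalescingRowKernelIdentity.lean`). The measure theory of (K) is isolated here, free of the model:

* `cmk_lintegral_condDistrib` — the regular conditional distribution `condDistrib Y X μ` of Mathlib, read
  as a DENSITY: for every measurable `H ≥ 0` on the statistic space,
  `∫ H(X) 1{Y ∈ s} dμ = ∫ H(X) · condDistrib Y X μ (X ·) s dμ` (the set version
  `setLIntegral_preimage_condDistrib` pushed to functions through the equality of two image measures).
* `cmk_abstract_sufficiency` (registered) — THE SUFFICIENCY LEMMA. On a triple product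
  `α ⊗ (ρ ⊗ β)` (lower noise `a`, shared data `θ`, upper noise `b`), if `K (θ, u, v)` is a conditional
  density of `{Y (θ,b) = y₀}` given `(θ, υ (θ,b), V (θ,b))` under `ρ ⊗ β`, then for EVERY measurable weight
  `G (a, θ, u, v)` — reading the lower noise `a` arbitrarily but the upper noise only through `(υ, V)` —
  `∫ G 1{Y = y₀} = ∫ G K`. (Tonelli: integrate `a` outermost and apply the density identity fibrewise with
  `H := G (a, ·)`.) In the model, `G` is the indicator that the row statistic (environment, strip diagram,
  middle rows below `0`) lies in a set: on a cut row the strip diagram is assembled from the lower half and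
  the upper half-diagram `υ`, so the indicator has exactly this form, and the lemma says that the
  conditional law of the middle row `0` given the row statistic is `K` — a function of the data above the cut.
-/

noncomputable section

namespace Summit.CriticalPhenomena.CardyFormulaZ2.Theorems.IKLinearTransport.PinnedDiagramExchange

open scoped Classical MeasureTheory ENNReal ProbabilityTheory
open Set MeasureTheory ProbabilityTheory

/-! ## The conditional distribution as a density against functions of the statistic -/

/-- THE CONDITIONAL DISTRIBUTION AS A DENSITY: for measurable `H ≥ 0` on the statistic space,
`∫ H(X) 1{Y ∈ s} dμ = ∫ H(X) condDistrib Y X μ (X ·) s dμ`. [folklore] -/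
theorem cmk_lintegral_condDistrib {Ω' T Yt : Type*} [MeasurableSpace Ω'] [MeasurableSpace T]
    [MeasurableSpace Yt] [StandardBorelSpace Yt] [Nonempty Yt]
    (μ : Measure Ω') [IsFiniteMeasure μ] {X : Ω' → T} {Y : Ω' → Yt} (hX : Measurable X) (hY : Measurable Y)
    {s : Set Yt} (hs : MeasurableSet s) {H : T → ℝ≥0∞} (hH : Measurable H) :
    ∫⁻ ω, H (X ω) * (Y ⁻¹' s).indicator (1 : Ω' → ℝ≥0∞) ω ∂μ = ∫⁻ ω, H (X ω) * condDistrib Y X μ (X ω) s ∂μ := by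
  have hk : Measurable fun ω => condDistrib Y X μ (X ω) s := (Kernel.measurable_coe _ hs).comp hX
  -- the two image measures on the statistic space agree
  have hm : (μ.restrict (Y ⁻¹' s)).map X = (μ.withDensity fun ω => condDistrib Y X μ (X ω) s).map X := by
    refine Measure.ext fun t ht => ?_
    rw [Measure.map_apply hX ht, Measure.map_apply hX ht, Measure.restrict_apply (hX ht),
      withDensity_apply _ (hX ht), setLIntegral_preimage_condDistrib hX hY.aemeasurable hs ht]
  have h1 : ∫⁻ t, H t ∂((μ.restrict (Y ⁻¹' s)).map X) = ∫⁻ ω, H (X ω) * (Y ⁻¹' s).indicator (1 : Ω' → ℝ≥0∞) ω ∂μ := by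
    rw [lintegral_map hH hX, ← lintegral_indicator (hY hs)]
    refine lintegral_congr fun ω => ?_
    by_cases hω : ω ∈ Y ⁻¹' s
    · rw [indicator_of_mem hω, indicator_of_mem hω, Pi.one_apply, mul_one]
    · rw [indicator_of_notMem hω, indicator_of_notMem hω, mul_zero]
  have h2 : ∫⁻ t, H t ∂((μ.withDensity fun ω => condDistrib Y X μ (X ω) s).map X) =
      ∫⁻ ω, H (X ω) * condDistrib Y X μ (X ω) s ∂μ := by
    rw [lintegral_map hH hX]
    have := lintegral_withDensity_eq_lintegral_mul μ hk (hH.comp hX)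
    refine this.trans (lintegral_congr fun ω => ?_)
    simp only [Pi.mul_apply, Function.comp_apply, mul_comm]
  rw [← h1, ← h2, hm]

/-- The density is bounded by one almost nowhere an issue: `condDistrib` is a Markov kernel, so its values on
sets are at most `1`. [folklore] -/
theorem cmk_condDistrib_le_one {Ω' T Yt : Type*} [MeasurableSpace Ω'] [MeasurableSpace T]
    [MeasurableSpace Yt] [StandardBorelSpace Yt] [Nonempty Yt]
    (μ : Measure Ω') [IsFiniteMeasure μ] (X : Ω' → T) (Y : Ω' → Yt) (t : T) (s : Set Yt) :
    condDistrib Y X μ t s ≤ 1 :=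
  prob_le_one

/-! ## The abstract sufficiency lemma -/

/-- THE ABSTRACT SUFFICIENCY LEMMA ACROSS AN INDEPENDENT CUT (registered sub-goal
`cmk_abstract_sufficiency`). Lower noise `a ∼ α`, shared data `θ ∼ ρ`, upper noise `b ∼ β`, independent.
If `K` is a conditional density of `{Y (θ, b) = y₀}` given `(θ, υ (θ, b), V (θ, b))` under `ρ ⊗ β`, then
against every measurable weight `G (a, θ, υ, V)` that reads the upper noise only through `(υ, V)`:
`∫ G · 1{Y = y₀} d(α ⊗ ρ ⊗ β) = ∫ G · K (θ, υ, V) d(α ⊗ ρ ⊗ β)`. [folklore] -/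
theorem cmk_abstract_sufficiency : ∀ {A Θ B U W Yt : Type*} [MeasurableSpace A] [MeasurableSpace Θ]
    [MeasurableSpace B] [MeasurableSpace U] [MeasurableSpace W] [MeasurableSpace Yt]
    (α : Measure A) (ρ : Measure Θ) (β : Measure B) [SFinite α] [SFinite ρ] [SFinite β]
    (υ : Θ × B → U) (V : Θ × B → W) (Y : Θ × B → Yt) (y₀ : Yt) (K : Θ × U × W → ℝ≥0∞),
    Measurable υ → Measurable V → Measurable Y → MeasurableSet ({y₀} : Set Yt) → Measurable K →
    (∀ H : Θ × U × W → ℝ≥0∞, Measurable H →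
      ∫⁻ ω, H (ω.1, υ ω, V ω) * (Y ⁻¹' {y₀}).indicator (1 : Θ × B → ℝ≥0∞) ω ∂(ρ.prod β) =
        ∫⁻ ω, H (ω.1, υ ω, V ω) * K (ω.1, υ ω, V ω) ∂(ρ.prod β)) →
    ∀ G : A × Θ × U × W → ℝ≥0∞, Measurable G →
      ∫⁻ p, G (p.1, p.2.1, υ p.2, V p.2) * ((fun p : A × Θ × B => Y p.2) ⁻¹' {y₀}).indicator (1 : A × Θ × B → ℝ≥0∞) p
          ∂(α.prod (ρ.prod β)) =
        ∫⁻ p, G (p.1, p.2.1, υ p.2, V p.2) * K (p.2.1, υ p.2, V p.2) ∂(α.prod (ρ.prod β)) := by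
  intro A Θ B U W Yt _ _ _ _ _ _ α ρ β _ _ _ υ V Y y₀ K hυ hV hY hy₀ hK hdef G hG
  -- measurability of the two integrands
  have hstat : Measurable fun p : A × Θ × B => (p.1, p.2.1, υ p.2, V p.2) :=
    measurable_fst.prodMk ((measurable_fst.comp measurable_snd).prodMk
      ((hυ.comp measurable_snd).prodMk (hV.comp measurable_snd)))
  have hGp : Measurable fun p : A × Θ × B => G (p.1, p.2.1, υ p.2, V p.2) := hG.comp hstat
  have hYp : Measurable fun p : A × Θ × B => Y p.2 := hY.comp measurable_snd
  have hInd : Measurable fun p : A × Θ × B => ((fun p : A × Θ × B => Y p.2) ⁻¹' {y₀}).indicator (1 : A × Θ × B → ℝ≥0∞) p :=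
    measurable_one.indicator (hYp hy₀)
  have hKp : Measurable fun p : A × Θ × B => K (p.2.1, υ p.2, V p.2) :=
    hK.comp ((measurable_fst.comp measurable_snd).prodMk ((hυ.comp measurable_snd).prodMk (hV.comp measurable_snd)))
  have m1 : Measurable fun p : A × Θ × B => G (p.1, p.2.1, υ p.2, V p.2) *
      ((fun p : A × Θ × B => Y p.2) ⁻¹' {y₀}).indicator (1 : A × Θ × B → ℝ≥0∞) p := hGp.mul hInd
  have m2 : Measurable fun p : A × Θ × B => G (p.1, p.2.1, υ p.2, V p.2) * K (p.2.1, υ p.2, V p.2) := hGp.mul hKp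
  rw [lintegral_prod _ m1.aemeasurable, lintegral_prod _ m2.aemeasurable]
  refine lintegral_congr fun a => ?_
  -- fibrewise, the density identity with `H := G (a, ·)`
  have hH : Measurable fun q : Θ × U × W => G (a, q) := hG.comp (measurable_const.prodMk measurable_id)
  have key := hdef (fun q => G (a, q)) hH
  have hind : ∀ ω : Θ × B, ((fun p : A × Θ × B => Y p.2) ⁻¹' {y₀}).indicator (1 : A × Θ × B → ℝ≥0∞) (a, ω) =
      (Y ⁻¹' {y₀}).indicator (1 : Θ × B → ℝ≥0∞) ω := by
    intro ω
    by_cases h : Y ω = y₀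
    · rw [indicator_of_mem (show (a, ω) ∈ (fun p : A × Θ × B => Y p.2) ⁻¹' {y₀} from h),
        indicator_of_mem (show ω ∈ Y ⁻¹' {y₀} from h)]; rfl
    · rw [indicator_of_notMem (show (a, ω) ∉ (fun p : A × Θ × B => Y p.2) ⁻¹' {y₀} from h),
        indicator_of_notMem (show ω ∉ Y ⁻¹' {y₀} from h)]
  simp only [hind]
  exact key

end Summit.CriticalPhenomena.CardyFormulaZ2.Theorems.IKLinearTransport.PinnedDiagramExchange
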